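import Summits.QuantumFields.YangMills.Theorems.LuscherReductionTwistedTraceScalingBOStiffCentralDensity
import Summits.QuantumFields.YangMills.Theorems.LuscherReductionTwistedTraceScalingBOStiffRing
import Summits.QuantumFields.YangMills.Theorems.FlatTubeReductionStiffKWeightTransport
import HarnessLib


/-!
# (B-ST) K-port, part 6: the CENTRAL WEIGHT/DENSITY identities and the RING MASS, at a GENERAL CAP CONSTANT `K ≥ 1`
# (route `FlatTubeReduction`, crux K1 `NearFlatRatioLaw` stmt-QuantumFields-24720, line `ratepack_v2`, stub `stub_hST_A`; seat `ym-line-ftr-p1` g20; R2b1 RECORD rung — no summit statement is proved here)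

Lane A's ✓`…BOStiffCentralWeight.cΘ_mul_cW_eq/cΘ_sq_mul_cW_eq`, ✓`…BOStiffCentralDensity.central_density_compare` and ✓`…BOStiffRing.eventually_ring_mass_le` VERBATIM with the cap
constant `43` of `recordChi L s 43 M β` replaced by a parameter `K ≥ 1` (the rate twin's stub `stub_hST_A` needs `K = 42·max 1 (|Site 3 L|/7) + 1` at `s = 1/6`), in the
K-vocabulary `cWK` of ✓`…FlatTubeReductionStiffKDefs`:
* `cΘ_mul_cWK_eq`, `cΘ_sq_mul_cWK_eq` — the central weight on the profile support as `𝟙·Gaussians·N(orthoTube 1 x)`;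
* ★★ `central_density_compare_K` — `cΘ²cWK = (1 ± ε)·cD` on `cS`, eventually;  ★★ `eventually_ring_mass_le_K` — the ring mass `∫_{cS∖I} cΘ²cWK ≤ σ·∫ cΘ²cWK`, eventually.
HONEST FRAMING: text port (slot substitution `43 ↦ K`) of lane A's bookkeeping for a stub of the crux K1 of the CONDITIONAL route R2b1 (RECORD rung); no new mathematics; not infinite volume,
not a gap, not Clay.
-/

set_option autoImplicit false

noncomputable section

open MeasureTheory Filter Topology Real
open scoped BigOperators
open Literature.MathematicalPhysics.QuantumFieldTheory
open Literature.MathematicalPhysics.QuantumLattice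

namespace Summit.QuantumFields.YangMills.Theorems.FemtoTransferGap.TwoLattice.ConstTube

open Summit.QuantumFields.YangMills.Theorems.FemtoTransferGap
open Summit.QuantumFields.YangMills.Theorems.FemtoTransferGap.TwoLattice
open Summit.QuantumFields.YangMills.Theorems.FemtoTransferGap.TwoLattice.Avg
open Summit.QuantumFields.YangMills.Theorems.FemtoTransferGap.TwoLattice.Stiff
open Summit.QuantumFields.YangMills.Theorems.FemtoTransferGap.TwoLattice.GnChart
open Summit.QuantumFields.YangMills.Theorems.FemtoTransferGap.TwoLattice.Cov
open Summit.QuantumFields.YangMills.Theorems.FemtoTransferGap.TwoLattice.Toron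
open Summit.QuantumFields.YangMills.Theorems.TwistedTraceScaling.Negative

variable {L : ℕ} [NeZero L]

/-! ## §1 The central weight on the profile support -/

/-- ★★ **The gauge Gaussian cancels**: `cΘ x · cWK x = e^{−q_β(x̂)} · gaugeAvg χ (orthoTube 1 x)` for `x ∈ cS β` with `orthoTube 1 x` in the record fat tube. [cite: Luscher1983, §3] -/
theorem cΘ_mul_cWK_eq (s K M β : ℝ) {x : Edge 3 L → Fin 3 → ℝ} (hx : x ∈ cS L β)
    (hF : orthoTube L 1 x ∈ fatTubeRho L (fun β => K * powScale s β) (fun b => M * (K * powScale s b)) β) :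
    cΘ L β x * cWK L s K M β x = Real.exp (-(stiffGaussExp L (β / 2) β (linkEmbed L x))) * gaugeAvg (recordChi L s K M β) (orthoTube L 1 x) := by
  have hcap := mem_capBalancedSet_of_mem_cS (L := L) β hx
  obtain ⟨-, hr⟩ := cΘ_eq_on_cS (L := L) β hx
  have hball : linkEmbed L x ∈ Metric.closedBall (0 : LinkSpace L) (min (1 / 40) (powScale (1 / 2) β * btLog β)) := by
    simpa [Metric.mem_closedBall, dist_zero_right] using hr
  have h := frozenProfile_mul_softWeight_recordChi (L := L) s K M β (fun β' => stiffGaussExp L (β' / 2) β') (fun β' => min (1 / 40) (powScale (1 / 2) β' * btLog β')) 1 hcap hF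
  have hind : {y : LinkSpace L | linkCurry y ∈ capBalancedSet L}.indicator (fun _ => (1 : ℝ)) (linkEmbed L x) = 1 :=
    Set.indicator_of_mem ((linkEmbed_mem_capLink_iff (L := L) x).2 hcap) _
  unfold cΘ cΩ cWK
  rw [hind, one_mul, h, Set.indicator_of_mem hball, mul_one]

/-- ★★ **The density of the fibre block**: `cΘ² · cWK = N(orthoTube 1 x) · e^{−‖P_Γ x̂‖²/β^{-2}} · e^{−2q_β(x̂)}` for `x ∈ cS β` with `orthoTube 1 x` in the fat tube. [cite: Luscher1983, §3] -/
theorem cΘ_sq_mul_cWK_eq (s K M β : ℝ) {x : Edge 3 L → Fin 3 → ℝ} (hx : x ∈ cS L β)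
    (hF : orthoTube L 1 x ∈ fatTubeRho L (fun β => K * powScale s β) (fun b => M * (K * powScale s b)) β) :
    cΘ L β x ^ 2 * cWK L s K M β x =
      gaugeAvg (recordChi L s K M β) (orthoTube L 1 x) * (Real.exp (-(‖(gaugeModes L).starProjection (linkEmbed L x)‖ ^ 2 / powScale 1 β ^ 2)) *
        Real.exp (-(2 * stiffGaussExp L (β / 2) β (linkEmbed L x)))) := by
  obtain ⟨e, -⟩ := cΘ_eq_on_cS (L := L) β hx
  have h := cΘ_mul_cWK_eq (L := L) s K M β hx hF
  calc cΘ L β x ^ 2 * cWK L s K M β x = cΘ L β x * (cΘ L β x * cWK L s K M β x) := by ring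
    _ = cΘ L β x * (Real.exp (-(stiffGaussExp L (β / 2) β (linkEmbed L x))) * gaugeAvg (recordChi L s K M β) (orthoTube L 1 x)) := by rw [h]
    _ = _ := by
      rw [e]
      have e2 : Real.exp (-(2 * stiffGaussExp L (β / 2) β (linkEmbed L x))) =
          Real.exp (-(stiffGaussExp L (β / 2) β (linkEmbed L x))) * Real.exp (-(stiffGaussExp L (β / 2) β (linkEmbed L x))) := by
        rw [← Real.exp_add]; ring_nf
      rw [e2]; ring

/-- ★★ **The density comparison `hν/hν'` of the fibre block with `Cν = C'ν = 1 + ε`**: for `L` with a non-zero site and `0 < s ≤ 1/3` there is `M₀ ≥ 2` such that for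
`M ≥ M₀` and every `ε > 0`, eventually in `β`, for all `x ∈ cS L β`:
`cΘ² cWK ≤ (1+ε)·N̄(β⁻¹)e^{−‖P_Γx̂‖²/β^{-2}}e^{−2q_β(x̂)}` and `N̄(β⁻¹)e^{−‖P_Γx̂‖²/β^{-2}}e^{−2q_β(x̂)} ≤ (1+ε)·cΘ² cWK`. [cite: Luscher1983, §3] -/
theorem central_density_compare_K {K : ℝ} (hK : 1 ≤ K) (hLz : Nonempty (NzSite L)) {s : ℝ} (hs : 0 < s) (hs3 : s ≤ 1 / 3) :
    ∃ M₀ : ℝ, 2 ≤ M₀ ∧ ∀ M : ℝ, M₀ ≤ M → ∀ ε : ℝ, 0 < ε → ∀ᶠ β : ℝ in atTop, ∀ x ∈ cS L β,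
      cΘ L β x ^ 2 * cWK L s K M β x ≤
          (1 + ε) * (fpWeightBar L (powScale 1 β) * (Real.exp (-(‖(gaugeModes L).starProjection (linkEmbed L x)‖ ^ 2 / powScale 1 β ^ 2)) *
            Real.exp (-(2 * stiffGaussExp L (β / 2) β (linkEmbed L x))))) ∧
        fpWeightBar L (powScale 1 β) * (Real.exp (-(‖(gaugeModes L).starProjection (linkEmbed L x)‖ ^ 2 / powScale 1 β ^ 2)) *
            Real.exp (-(2 * stiffGaussExp L (β / 2) β (linkEmbed L x)))) ≤
          (1 + ε) * (cΘ L β x ^ 2 * cWK L s K M β x) := by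
  -- (P): the Faddeev–Popov weight is constant on the fat tube of record
  have hK0 : 0 < K := lt_of_lt_of_le one_pos hK
  have hδ0 : ∀ β, 0 < K * powScale s β := fun β => mul_pos hK0 (powScale_pos s β)
  have hδ : Tendsto (fun β => K * powScale s β) atTop (𝓝 0) := by simpa using (tendsto_powScale hs).const_mul K
  have hsd1 : ∀ᶠ β in atTop, 0 < powScale 1 β ∧ powScale 1 β ≤ (K * powScale s β) ^ 3 := by
    filter_upwards [eventually_ge_atTop (1 : ℝ)] with β hβ
    have h1 : powScale 1 β ≤ powScale s β ^ 3 := powScale_one_le_cube hs3 hβ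
    have hps0 : 0 ≤ powScale s β ^ 3 := pow_nonneg (powScale_pos s β).le 3
    refine ⟨powScale_pos 1 β, h1.trans ?_⟩
    calc powScale s β ^ 3 = 1 * powScale s β ^ 3 := (one_mul _).symm
      _ ≤ K ^ 3 * powScale s β ^ 3 := mul_le_mul_of_nonneg_right (one_le_pow₀ hK) hps0
      _ = (K * powScale s β) ^ 3 := by ring
  obtain ⟨M₀, hM₀, H⟩ := fpWeight_core_constant L hLz hδ0 hδ hsd1
  refine ⟨M₀, hM₀, fun M hM ε hε => ?_⟩
  obtain ⟨C, β₀, hC, hP⟩ := H M hM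
  have hM2 : 2 ≤ M := hM₀.trans hM
  have hδ2 : Tendsto (fun β => (K * powScale s β) ^ 2) atTop (𝓝 0) := by simpa using hδ.pow 2
  have hκ : (0 : ℝ) < ε / (1 + ε) := by positivity
  have hs2 : s < 1 / 2 := by linarith
  filter_upwards [eventually_ge_atTop β₀, eventually_mul_le_of_tendsto hδ2 C hκ, eventually_orthoTube_one_mem_fatTube_K (L := L) hK hs hs2 hM2] with β hβ hCδ hfat x hx
  -- the fat tube contains the central tube point
  have hne : cΘ L β x ≠ 0 := hx
  unfold cΘ cΩ at hne
  have hF := hfat x hne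
  -- (P) at that point, in the vocabulary of `recordChi`
  have hPx := hP β hβ (orthoTube L 1 x) hF
  have hNeq : gaugeAvg (recordWeightRho L (fun β => K * powScale s β) (fun b => M * (K * powScale s b)) (powScale 1) β) (orthoTube L 1 x) =
      gaugeAvg (recordChi L s K M β) (orthoTube L 1 x) := by rfl
  rw [hNeq] at hPx
  obtain ⟨hlo, hhi⟩ := hPx
  set N := gaugeAvg (recordChi L s K M β) (orthoTube L 1 x) with hN
  set Nbar := fpWeightBar L (powScale 1 β) with hNbar
  set δ2 := (K * powScale s β) ^ 2 with hδ2def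
  set G := Real.exp (-(‖(gaugeModes L).starProjection (linkEmbed L x)‖ ^ 2 / powScale 1 β ^ 2)) *
      Real.exp (-(2 * stiffGaussExp L (β / 2) β (linkEmbed L x))) with hG
  have hG0 : 0 < G := mul_pos (Real.exp_pos _) (Real.exp_pos _)
  have hNbar0 : 0 < Nbar := fpWeightBar_pos L (powScale_pos 1 β)
  have hid : cΘ L β x ^ 2 * cWK L s K M β x = N * G := by rw [hN, hG]; exact cΘ_sq_mul_cWK_eq (L := L) s K M β hx hF
  -- `Cδ² ≤ ε/(1+ε) ≤ ε`, so `1 + Cδ² ≤ 1 + ε` and `1 ≤ (1+ε)(1 − Cδ²)`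
  have hCδ' : C * δ2 ≤ ε := hCδ.trans (div_le_self hε.le (by linarith))
  have hCδ0 : 0 ≤ C * δ2 := mul_nonneg hC (sq_nonneg _)
  have h1ε : (1 + ε) * (ε / (1 + ε)) = ε := by field_simp
  have hlow : 1 ≤ (1 + ε) * (1 - C * δ2) := by nlinarith
  rw [hid]
  constructor
  · calc N * G ≤ Nbar * (1 + C * δ2) * G := mul_le_mul_of_nonneg_right hhi hG0.le
      _ ≤ Nbar * (1 + ε) * G := by gcongr
      _ = (1 + ε) * (Nbar * G) := by ring
  · calc Nbar * G = 1 * (Nbar * G) := (one_mul _).symm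
      _ ≤ (1 + ε) * (1 - C * δ2) * (Nbar * G) := mul_le_mul_of_nonneg_right hlow (mul_pos hNbar0 hG0).le
      _ = (1 + ε) * (Nbar * (1 - C * δ2) * G) := by ring
      _ ≤ (1 + ε) * (N * G) := by
          have h := mul_le_mul_of_nonneg_right hlo hG0.le
          exact mul_le_mul_of_nonneg_left h (by linarith)

set_option maxHeartbeats 1600000 in
-- long record expressions.
/-- ★★ **RING MASS**: `∃ M₀ ≥ 2, ∀ M ≥ M₀, ∀ σ > 0, ∀ᶠ β, ∫_{cS β ∖ I(β)} cΘ²cW dπ ≤ σ·∫ cΘ²cW dπ`, `I(β) = cS β ∩ {‖x̂‖ ≤ r_f(β)/12}`. [cite: Luscher1983, §3] -/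
theorem eventually_ring_mass_le_K {K : ℝ} (hK : 1 ≤ K) (hLz : Nonempty (NzSite L)) (hL : 2 ≤ L) {s : ℝ} (hs : 0 < s) (hs3 : s ≤ 1 / 3) :
    ∃ M₀ : ℝ, 2 ≤ M₀ ∧ ∀ M : ℝ, M₀ ≤ M → ∀ σ : ℝ, 0 < σ → ∀ᶠ β : ℝ in atTop,
      ∫ x in cS L β \ (cS L β ∩ {x | ‖linkEmbed L x‖ ≤ min (1 / 40) (powScale (1 / 2) β * btLog β) / 12}), cΘ L β x ^ 2 * cWK L s K M β x ∂orthoTransverse L ≤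
        σ * ∫ x, cΘ L β x ^ 2 * cWK L s K M β x ∂orthoTransverse L := by
  haveI := isFiniteMeasure_orthoTransverse L
  obtain ⟨M₀, hM₀, H⟩ := fpWeight_record_sandwich_K (L := L) hK hLz hs hs3
  refine ⟨M₀, hM₀, fun M hM σ hσ => ?_⟩
  obtain ⟨C, β₀, hC, hP⟩ := H M hM
  have hM2 : 2 ≤ M := hM₀.trans hM
  have hδ : Tendsto (fun β => K * powScale s β) atTop (𝓝 0) := by simpa using (tendsto_powScale hs).const_mul K
  have hδ2 : Tendsto (fun β => (K * powScale s β) ^ 2) atTop (𝓝 0) := by simpa using hδ.pow 2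
  have ha : 0 < σ / 3 := by positivity
  filter_upwards [eventually_ge_atTop β₀, eventually_mul_le_of_tendsto hδ2 C (by norm_num : (0 : ℝ) < 1 / 2),
    eventually_orthoTube_one_mem_fatTube_of_norm_le_K (L := L) hK hs (by linarith) hM2, massRatio_le_one_add (L := L) hL ha, eventually_ge_atTop (0 : ℝ)]
    with β hβ₀ hκ hcore hratio hβ0
  -- names
  set rf : ℝ := min (1 / 40) (powScale (1 / 2) β * btLog β) with hrf
  set Nbar : ℝ := fpWeightBar L (powScale 1 β) with hNbar
  set κ : ℝ := C * (K * powScale s β) ^ 2 with hκdef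
  have hκ0 : 0 ≤ κ := by positivity
  have hN0 : 0 < Nbar := fpWeightBar_pos L (powScale_pos 1 β)
  set f : (Edge 3 L → Fin 3 → ℝ) → ℝ := fun v => Real.exp (-(stiffGaussExp L (β / 2) β (linkEmbed L v))) ^ 2 *
    Real.exp (-(‖(gaugeModes L).starProjection (linkEmbed L v)‖ ^ 2 / powScale 1 β ^ 2)) with hfdef
  have hf0 : ∀ v, 0 ≤ f v := fun v => by positivity
  have hf1 : ∀ v, f v ≤ 1 := fun v => by
    have h1 : Real.exp (-(stiffGaussExp L (β / 2) β (linkEmbed L v))) ≤ 1 := Real.exp_le_one_iff.mpr (neg_nonpos.mpr (stiffGaussExp_nonneg _ _ _))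
    have h2 : Real.exp (-(‖(gaugeModes L).starProjection (linkEmbed L v)‖ ^ 2 / powScale 1 β ^ 2)) ≤ 1 := Real.exp_le_one_iff.mpr (neg_nonpos.mpr (by positivity))
    calc f v ≤ 1 ^ 2 * 1 := mul_le_mul (pow_le_pow_left₀ (Real.exp_pos _).le h1 2) h2 (Real.exp_pos _).le (by positivity)
      _ = 1 := by norm_num
  have hfm : Measurable f := by
    have h1 : Measurable fun v : Edge 3 L → Fin 3 → ℝ => stiffGaussExp L (β / 2) β (linkEmbed L v) := (measurable_stiffGaussExp _ _).comp (measurable_linkEmbed (L := L))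
    have h2 : Measurable fun v : Edge 3 L → Fin 3 → ℝ => ‖(gaugeModes L).starProjection (linkEmbed L v)‖ :=
      ((gaugeModes L).starProjection.continuous.measurable.comp (measurable_linkEmbed (L := L))).norm
    exact ((Real.measurable_exp.comp h1.neg).pow_const 2).mul (Real.measurable_exp.comp ((h2.pow_const 2).div_const _).neg)
  set A : ℝ := ∫ v, {v : Edge 3 L → Fin 3 → ℝ | ‖linkEmbed L v‖ ≤ rf}.indicator (fun _ => (1 : ℝ)) v * f v ∂orthoTransverse L with hAdef
  set B : ℝ := ∫ v, {v : Edge 3 L → Fin 3 → ℝ | ‖linkEmbed L v‖ ≤ rf / 12}.indicator (fun _ => (1 : ℝ)) v * f v ∂orthoTransverse L with hBdef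
  have hAB : A ≤ (1 + σ / 3) * B := hratio
  -- the density identity on `cS`
  obtain ⟨-, -, -, -, hΘm, hΘ1, hΘ0, hΘS, hSm⟩ := central_kform_data (L := L) hβ0
  obtain ⟨hwm, hwb, hw0⟩ := cWK_props (L := L) s K M β
  have hdens : ∀ x ∈ cS L β, cΘ L β x ^ 2 * cWK L s K M β x = gaugeAvg (recordChi L s K M β) (orthoTube L 1 x) * f x := fun x hx => by
    have hF := hcore x (mem_cS hx).2
    rw [cΘ_sq_mul_cWK_eq s K M β hx hF, hfdef]
    simp only
    rw [← Real.exp_nat_mul]; push_cast; ring_nf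
  have hNup : ∀ x ∈ cS L β, gaugeAvg (recordChi L s K M β) (orthoTube L 1 x) ≤ Nbar * (1 + κ) := fun x hx => (hP β hβ₀ _ (hcore x (mem_cS hx).2)).2
  have hNlo : ∀ x ∈ cS L β, Nbar * (1 - κ) ≤ gaugeAvg (recordChi L s K M β) (orthoTube L 1 x) := fun x hx => (hP β hβ₀ _ (hcore x (mem_cS hx).2)).1
  -- measurable sets
  have hBall : ∀ R : ℝ, MeasurableSet {v : Edge 3 L → Fin 3 → ℝ | ‖linkEmbed L v‖ ≤ R} := fun R =>
    measurableSet_le (measurable_linkEmbed (L := L)).norm measurable_const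
  set I : Set (Edge 3 L → Fin 3 → ℝ) := cS L β ∩ {x | ‖linkEmbed L x‖ ≤ rf / 12} with hIdef
  have hIm : MeasurableSet I := hSm.inter (hBall _)
  -- integrability of `cΘ²cW`
  have hgm : Measurable fun x => cΘ L β x ^ 2 * cWK L s K M β x := (hΘm.pow_const 2).mul hwm
  have hgi : Integrable (fun x => cΘ L β x ^ 2 * cWK L s K M β x) (orthoTransverse L) :=
    integrable_of_measurable_abs_le _ hgm (C := 1 * Real.exp ((Fintype.card (Edge 3 L) : ℝ) / powScale 1 β ^ 2)) fun x => by
      rw [abs_mul, abs_pow]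
      exact mul_le_mul (by rw [← one_pow 2]; exact pow_le_pow_left₀ (abs_nonneg _) (hΘ1 x) 2) (hwb x) (abs_nonneg _) zero_le_one
  have hg0 : ∀ x, 0 ≤ cΘ L β x ^ 2 * cWK L s K M β x := fun x => mul_nonneg (sq_nonneg _) (hw0 x)
  have hind_i : ∀ R : ℝ, Integrable (fun v => {v : Edge 3 L → Fin 3 → ℝ | ‖linkEmbed L v‖ ≤ R}.indicator (fun _ => (1 : ℝ)) v * f v) (orthoTransverse L) := fun R =>
    integrable_of_measurable_abs_le _ ((measurable_const.indicator (hBall R)).mul hfm) (C := 1) fun v => by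
      rw [abs_mul, abs_of_nonneg (hf0 v)]
      by_cases hv : v ∈ {v : Edge 3 L → Fin 3 → ℝ | ‖linkEmbed L v‖ ≤ R}
      · rw [Set.indicator_of_mem hv, abs_one, one_mul]; exact hf1 v
      · rw [Set.indicator_of_notMem hv, abs_zero, zero_mul]; exact zero_le_one
  -- (1) the ring mass `≤ N̄(1+κ)·(A − B)`
  have h1 : ∫ x in cS L β \ I, cΘ L β x ^ 2 * cWK L s K M β x ∂orthoTransverse L ≤ Nbar * (1 + κ) * (A - B) := by
    rw [← integral_indicator (hSm.diff hIm), hAdef, hBdef, ← integral_sub (hind_i _) (hind_i _), ← integral_const_mul]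
    refine integral_mono ?_ (((hind_i _).sub (hind_i _)).const_mul _) fun x => ?_
    · exact hgi.indicator (hSm.diff hIm)
    · show (cS L β \ I).indicator (fun x => cΘ L β x ^ 2 * cWK L s K M β x) x ≤
        Nbar * (1 + κ) * ({v : Edge 3 L → Fin 3 → ℝ | ‖linkEmbed L v‖ ≤ rf}.indicator (fun _ => (1 : ℝ)) x * f x -
          {v : Edge 3 L → Fin 3 → ℝ | ‖linkEmbed L v‖ ≤ rf / 12}.indicator (fun _ => (1 : ℝ)) x * f x)
      by_cases hx : x ∈ cS L β \ I
      · have hxS := hx.1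
        have hxr : ‖linkEmbed L x‖ ≤ rf := (mem_cS hxS).2
        have hxi : ¬ ‖linkEmbed L x‖ ≤ rf / 12 := fun h => hx.2 ⟨hxS, h⟩
        rw [Set.indicator_of_mem hx, Set.indicator_of_mem (show x ∈ {v : Edge 3 L → Fin 3 → ℝ | ‖linkEmbed L v‖ ≤ rf} from hxr),
          Set.indicator_of_notMem (show x ∉ {v : Edge 3 L → Fin 3 → ℝ | ‖linkEmbed L v‖ ≤ rf / 12} from hxi), one_mul, zero_mul, sub_zero, hdens x hxS]
        exact mul_le_mul_of_nonneg_right (hNup x hxS) (hf0 x)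
      · rw [Set.indicator_of_notMem hx]
        refine mul_nonneg (by positivity) ?_
        by_cases h12 : x ∈ {v : Edge 3 L → Fin 3 → ℝ | ‖linkEmbed L v‖ ≤ rf / 12}
        · have hr : x ∈ {v : Edge 3 L → Fin 3 → ℝ | ‖linkEmbed L v‖ ≤ rf} := by
            show ‖linkEmbed L x‖ ≤ rf
            have h := (show ‖linkEmbed L x‖ ≤ rf / 12 from h12)
            have hrf0 : 0 ≤ rf := le_trans (norm_nonneg _) (h.trans (by linarith [norm_nonneg (linkEmbed L x)]))
            linarith
          rw [Set.indicator_of_mem h12, Set.indicator_of_mem hr, sub_self]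
        · rw [Set.indicator_of_notMem h12, zero_mul, sub_zero]; exact mul_nonneg (Set.indicator_nonneg (fun _ _ => zero_le_one) _) (hf0 x)
  -- (2) the total mass `≥ N̄(1−κ)·A`
  have hae : ∀ᵐ v ∂orthoTransverse L, v ∈ capBalancedSet L := by rw [ae_iff]; exact orthoTransverse_compl_capBalancedSet L
  have h2 : Nbar * (1 - κ) * A ≤ ∫ x, cΘ L β x ^ 2 * cWK L s K M β x ∂orthoTransverse L := by
    rw [hAdef, ← integral_const_mul]
    refine integral_mono_ae ((hind_i _).const_mul _) hgi (hae.mono fun x hcap => ?_)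
    show Nbar * (1 - κ) * ({v : Edge 3 L → Fin 3 → ℝ | ‖linkEmbed L v‖ ≤ rf}.indicator (fun _ => (1 : ℝ)) x * f x) ≤ cΘ L β x ^ 2 * cWK L s K M β x
    by_cases hxr : ‖linkEmbed L x‖ ≤ rf
    · have hxS : x ∈ cS L β := (mem_cS_iff β x).mpr ⟨hcap, hxr⟩
      rw [Set.indicator_of_mem (show x ∈ {v : Edge 3 L → Fin 3 → ℝ | ‖linkEmbed L v‖ ≤ rf} from hxr), one_mul, hdens x hxS]
      exact mul_le_mul_of_nonneg_right (hNlo x hxS) (hf0 x)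
    · rw [Set.indicator_of_notMem (show x ∉ {v : Edge 3 L → Fin 3 → ℝ | ‖linkEmbed L v‖ ≤ rf} from hxr), zero_mul, mul_zero]; exact hg0 x
  -- (3) algebra: `ring ≤ N̄(1+κ)(A − B) ≤ N̄(1+κ)(σ/3)B ≤ N̄(1+κ)(σ/3)A ≤ σ·N̄(1−κ)A ≤ σ·total`
  have hB0 : 0 ≤ B := integral_nonneg fun v => mul_nonneg (Set.indicator_nonneg (fun _ _ => zero_le_one) _) (hf0 v)
  have hBA : B ≤ A := by
    refine integral_mono (hind_i _) (hind_i _) fun v => mul_le_mul_of_nonneg_right ?_ (hf0 v)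
    refine Set.indicator_le_indicator_of_subset (fun v hv => ?_) (fun _ => zero_le_one) v
    show ‖linkEmbed L v‖ ≤ rf
    have h : ‖linkEmbed L v‖ ≤ rf / 12 := hv
    have : 0 ≤ rf := le_trans (norm_nonneg _) (h.trans (by linarith [norm_nonneg (linkEmbed L v)]))
    linarith
  have hA0 : 0 ≤ A := hB0.trans hBA
  calc ∫ x in cS L β \ I, cΘ L β x ^ 2 * cWK L s K M β x ∂orthoTransverse L ≤ Nbar * (1 + κ) * (A - B) := h1
    _ ≤ Nbar * (1 + κ) * (σ / 3 * A) := mul_le_mul_of_nonneg_left (by nlinarith) (by positivity)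
    _ = σ * (Nbar * A) * ((1 + κ) / 3) := by ring
    _ ≤ σ * (Nbar * A) * (1 - κ) := mul_le_mul_of_nonneg_left (by linarith) (mul_nonneg hσ.le (mul_nonneg hN0.le hA0))
    _ = σ * (Nbar * (1 - κ) * A) := by ring
    _ ≤ σ * ∫ x, cΘ L β x ^ 2 * cWK L s K M β x ∂orthoTransverse L := mul_le_mul_of_nonneg_left h2 hσ.le

end Summit.QuantumFields.YangMills.Theorems.FemtoTransferGap.TwoLattice.ConstTube

end
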